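import Literature.AlgebraicGeometry.Frobenioids.DivisorMonoidCategoryTheoreticityDefs
import Literature.AlgebraicGeometry.Frobenioids.DegreeModelFrobenioid
import Literature.AlgebraicGeometry.Frobenioids.ElementaryFrobenioidMap
import Literature.AlgebraicGeometry.Frobenioids.ElementaryFrobeniusFunctor
import Literature.AlgebraicGeometry.Frobenioids.PreFrobenioidDataOfFunctor
import HarnessLib

/-!
# Frobenioids I, Theorem 4.2 (ii), (iii) AS TYPED (`PreFrobenioidData.Thm42ii`, `Thm42iii`): the universal
# closures over the bare operations interface are REFUTABLE (FACT-LIST rows F-1054 / F-1055, schema / R5)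

Mochizuki, *The geometry of Frobenioids I: the general theory*, Kyushu J. Math. **62** (2008) 293–400, kurims text,
Theorem 4.2 (ii) p. 77 ("the equivalence of categories `Ψ` induces a bijection `Ψ^Prime` …") and (iii) p. 78 ("the
bijections … arise from isomorphisms of monoids `Φ₁(A₁)_{𝔭₁} ⥲ Φ₂(A₂)_{𝔭₂}`") [cite: MochizukiFrdI2008, Thm. 4.2 (ii) p.77];
Definition 1.1 (iii) p. 20 ("the assignment `Φ ↦ F_Φ` is functorial with respect to homomorphisms … `Φ → Φ'`")
[cite: MochizukiFrdI2008, Def. 1.1 (iii) p.20]; Prop. 2.1 (ii) p. 44 / Def. 2.4 (iii) p. 48 (the Frobenius functor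
"multiplication by `d`" `F_Φ → F_Φ`); Theorem 5.2 pp. 100–101 (model Frobenioids).

Negative knowledge recorded next to `DivisorMonoidCategoryTheoreticityDefs.lean` (statements, seat abc-iut-L1-t3),
PROOF-ONLY (no definitions, no instances; the two counter-models are the operations of COMPOSITE pre-Frobenioids
`C → F_Φ → F_{Φ'}` built from landed functors), cell abc-iut, F fact-proving wave, seat abc-iut-f-036; companion of
seat abc-iut-f-017's `BaseCategoryTheoreticitySchemaNegative.lean` (same method for the §3 rows). The two rows are
conclusion predicates PARAMETRISED over the bare operations interface `S_i : PreFrobenioidData C_i D_i` (Def. 1.1 (iv):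
`Base`, `Div`, `deg_Fr` with the laws of Rem. 1.1.1 — NOT the Frobenioid axioms of Def. 1.3), an arbitrary equivalence
`Ψ : C₁ ≌ C₂` and, for (iii), an ARBITRARY family `e` of prime bijections; their hypotheses `Thm42Setting` (standard
and isotropic type, not group-like) are predicates on the operations too. Print asserts (ii), (iii) for FROBENIOIDS
(with `Φ_i` perf-factorial, and (iii) for THE family of (ii)); in that instance form the tree PROVES them —
`FrdI.T42.thm42ii_ofFunctor_of_isOfFSMFFType2024`, `FrdI.T42.thm42iii_ofFunctor_of_isOfFSMFFType2024`,
`FrdI.T42.thm42ii_iii_ofFunctor_of_isOfFSMFFType2024` (bases FSMFF in the author's 2024 sense),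
`FrdI.T42.thm42ii_ofFunctor_of_preservesPreSteps` / `thm42iii_…` (modulo Thm. 3.4 (ii)),
`PreFrobenioidData.thm42ii_of_perfectType_asPrinted` (perfect type, printed hypotheses) — cited, not restated.
Over the bare interface the closures are FALSE, for the same reason as Prop. 3.11 (ii) in f-017's file: the interface
admits pre-Frobenioids that are not Frobenioids. Witnesses (all data landed: abc-iut-L1-d4's degree model `DegreeModel`
— the model Frobenioid of `(pt, ℤ_{≥0}, 0, 0)`, a Frobenioid of standard and isotropic, non-group-like type by
Thm. 5.2 —, abc-iut-w4-d018's `ElemFrobenioid.map κ : F_Φ ⥤ F_{Φ'}`, abc-iut-L6-t9's `powEnd Φ d : Φ ⟶ Φ`):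

* **dictionary** (`PreFrobenioidData.ofFunctor_compMap_*`): for a pre-Frobenioid `F : C → F_Φ` and an INJECTIVE
  homomorphism `κ : Φ → Φ'` of monoids on `D`, the operations of `C → F_Φ → F_{Φ'}` have the same isometries,
  co-angular arrows, arrows of Frobenius type, isotropic / group-like / Frobenius-compact objects as those of
  `C → F_Φ` (same `Base`, same `deg_Fr`, `Div' = κ ∘ Div`); hence standard type, isotropic type and "not
  group-like" — the typed hypotheses of Thm. 4.2 — TRANSPORT to the composite (`thm42Setting_ofFunctor_compMap`),
  given only that `Φ'` is non-dilating (automatic over the one-morphism base: `isNonDilatingOn_of_end_eq_id`);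
* **(ii), F-1054** (`DegreeModel.not_thm42ii_diag`, `not_forall_thm42ii`): `κ = diag : Φ → Φ × Φ`, `Ψ = 𝟭_C`:
  `Prime(ℤ_{≥0})` is a point, `Prime(ℤ_{≥0} × ℤ_{≥0})` has two elements (`subsingleton_primes_N`,
  `exists_ne_primes_prod`), so NO family `Ψ^Prime_A : Prime(Φ₁(A)) ≃ Prime(Φ₂(Ψ A))` exists;
* **(iii), F-1055** (`DegreeModel.not_thm42iii_powEnd`, `not_forall_thm42iii`): `κ = [2] : Φ → Φ` (the Frobenius
  functor of degree `2`), `Ψ = 𝟭_C`, `e = id`: at the Div-Frobenius-trivial object `ι 0` of degree `0`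
  (`isDivFrobeniusTrivial_ι_zero`) a right-hand isomorphism of monoids `r : Φ(pt)_𝔭 ⥲ Φ(pt)_𝔭` computing the
  divisors of the images of the co-angular pre-steps `ι 0 → ι x` (`exists_coAngularPreStep_div_eq`) would be
  `x ↦ 2x` on `ℤ_{≥0}`, which misses `1`.

So each row is admissible ONLY in its instance form (FACT-LIST class «universal-closure REFUTED; instance form
PROVED»; cell rule R5). Refuted at universe `0` (small categories in `Type`). Classical bookkeeping about [FrdI] §4;
nothing here bears on the disputed [IUTchIII] Cor. 3.12 or takes a side; a refuted closure is never a fact, and no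
statement of the paper is asserted false.
-/

namespace Literature.AlgebraicGeometry.Frobenioids

open CategoryTheory Opposite

universe w v v' u u'

/-! ### The Def. 1.2 / Def. 3.1 (i) dictionary along an injective change of divisor monoid `κ : Φ → Φ'`
(Def. 1.1 (iii) "`Φ ↦ F_Φ` is functorial"), at the level of the operations `PreFrobenioidData.ofFunctor` -/

namespace PreFrobenioidData

section CompMap

variable {D : Type u} [Category.{v} D] {Φ Φ' : Dᵒᵖ ⥤ CommMonCat.{w}} {C : Type u'} [Category.{v'} C]
  (F : C ⥤ ElemFrobenioid Φ) (κ : Φ ⟶ Φ') (hκ : ∀ A : Dᵒᵖ, Function.Injective (κ.app A).hom)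
include hκ

/-- Isometries of `C → F_Φ → F_{Φ'}` are those of `C → F_Φ` when `κ` is injective (`Div' = κ ∘ Div`).
[cite: MochizukiFrdI2008, Def. 1.2 (i) p.21] -/
theorem ofFunctor_compMap_isIsometry_iff {A B : C} (φ : A ⟶ B) :
    (ofFunctor Φ' (F ⋙ ElemFrobenioid.map κ)).IsIsometry φ ↔ (ofFunctor Φ F).IsIsometry φ :=
  map_eq_one_iff _ (hκ _)

/-- Isometric pre-steps are the same. [cite: MochizukiFrdI2008, Def. 1.2 (iii) p.22] -/
theorem ofFunctor_compMap_isIsometricPreStep_iff {A B : C} (φ : A ⟶ B) :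
    (ofFunctor Φ' (F ⋙ ElemFrobenioid.map κ)).IsIsometricPreStep φ ↔ (ofFunctor Φ F).IsIsometricPreStep φ :=
  and_congr Iff.rfl (ofFunctor_compMap_isIsometry_iff F κ hκ φ)

/-- Co-angular morphisms are the same. [cite: MochizukiFrdI2008, Def. 1.2 (iii) p.22] -/
theorem ofFunctor_compMap_isCoAngular_iff {A B : C} (φ : A ⟶ B) :
    (ofFunctor Φ' (F ⋙ ElemFrobenioid.map κ)).IsCoAngular φ ↔ (ofFunctor Φ F).IsCoAngular φ :=
  ⟨fun h _ _ γ β α hc hl hβ hb => h γ β α hc hl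
      ((ofFunctor_compMap_isIsometricPreStep_iff F κ hκ β).mpr hβ) hb,
    fun h _ _ γ β α hc hl hβ hb => h γ β α hc hl
      ((ofFunctor_compMap_isIsometricPreStep_iff F κ hκ β).mp hβ) hb⟩

/-- Morphisms of Frobenius type are the same. [cite: MochizukiFrdI2008, Def. 1.2 (iii) p.22] -/
theorem ofFunctor_compMap_isFrobeniusType_iff {A B : C} (φ : A ⟶ B) :
    (ofFunctor Φ' (F ⋙ ElemFrobenioid.map κ)).IsFrobeniusType φ ↔ (ofFunctor Φ F).IsFrobeniusType φ :=
  and_congr (and_congr (ofFunctor_compMap_isCoAngular_iff F κ hκ φ) (ofFunctor_compMap_isIsometry_iff F κ hκ φ))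
    Iff.rfl

/-- Isotropic objects are the same. [cite: MochizukiFrdI2008, Def. 1.2 (iv) p.23] -/
theorem ofFunctor_compMap_isIsotropic_iff (A : C) :
    (ofFunctor Φ' (F ⋙ ElemFrobenioid.map κ)).IsIsotropic A ↔ (ofFunctor Φ F).IsIsotropic A :=
  forall_congr' fun _ => forall_congr' fun φ =>
    imp_congr (ofFunctor_compMap_isIsometricPreStep_iff F κ hκ φ) Iff.rfl

/-- Group-like objects of `C → F_{Φ'}` are group-like for `C → F_Φ` (`κ` injective).
[cite: MochizukiFrdI2008, Def. 1.2 (iv) p.23] -/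
theorem ofFunctor_compMap_isGroupLikeObj_imp (A : C)
    (h : (ofFunctor Φ' (F ⋙ ElemFrobenioid.map κ)).IsGroupLikeObj A) : (ofFunctor Φ F).IsGroupLikeObj A :=
  fun x => hκ (op (PreFrobenioid.baseObj F A)) (((h ((κ.app _).hom x)).trans (map_one (κ.app _).hom).symm))

/-- **Standard type transports along an injective change of divisor monoid**, given clause (e) (non-dilating) for
the new monoid: clauses (a) quasi-isotropic / Frobenius-isotropic, (b), (c) Frobenius-normalized and (d) FSMFF base
of Def. 3.1 (i) do not see `Φ` beyond isometries. [cite: MochizukiFrdI2008, Def. 3.1 (i) p.56] -/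
theorem ofFunctor_compMap_isOfStandardType (hS : (ofFunctor Φ F).IsOfStandardType)
    (he : (ofFunctor Φ' (F ⋙ ElemFrobenioid.map κ)).IsNonDilatingOn) :
    (ofFunctor Φ' (F ⋙ ElemFrobenioid.map κ)).IsOfStandardType where
  quasiIsotropic := ⟨fun A => by
    rw [ofFunctor_compMap_isIsotropic_iff F κ hκ A]
    exact hS.quasiIsotropic.nonIsotropic_iff A⟩
  frobeniusIsotropic := ⟨fun A => by
    obtain ⟨B, φ, hφ, hB⟩ := hS.frobeniusIsotropic.obj A
    exact ⟨B, φ, (ofFunctor_compMap_isFrobeniusType_iff F κ hκ φ).mpr hφ,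
      (ofFunctor_compMap_isIsotropic_iff F κ hκ B).mpr hB⟩⟩
  frobeniusCompact_of_groupLike hg := by
    obtain ⟨A, hA, hA'⟩ := hS.frobeniusCompact_of_groupLike
      ⟨fun A => ofFunctor_compMap_isGroupLikeObj_imp F κ hκ A (hg.obj A)⟩
    exact ⟨A, (ofFunctor_compMap_isIsotropic_iff F κ hκ A).mpr hA, hA'⟩
  frobeniusNormalized := ⟨fun A => hS.frobeniusNormalized.obj A⟩
  fsmff := hS.fsmff
  nonDilating := he

/-- Isotropic type transports. [cite: MochizukiFrdI2008, Def. 1.2 (v) p.23] -/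
theorem ofFunctor_compMap_isOfIsotropicType (h : (ofFunctor Φ F).IsOfIsotropicType) :
    (ofFunctor Φ' (F ⋙ ElemFrobenioid.map κ)).IsOfIsotropicType :=
  ⟨fun A => (ofFunctor_compMap_isIsotropic_iff F κ hκ A).mpr (h.obj A)⟩

/-- Not of group-like type transports. [cite: MochizukiFrdI2008, Def. 1.2 (v) p.23] -/
theorem ofFunctor_compMap_not_isOfGroupLikeType (h : ¬ (ofFunctor Φ F).IsOfGroupLikeType) :
    ¬ (ofFunctor Φ' (F ⋙ ElemFrobenioid.map κ)).IsOfGroupLikeType :=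
  fun hg => h ⟨fun A => ofFunctor_compMap_isGroupLikeObj_imp F κ hκ A (hg.obj A)⟩

/-- **The hypotheses of Thm. 4.2 AS TYPED (`Thm42Setting`) for the pair (`C → F_Φ`, `C → F_Φ → F_{Φ'}`)** from
those for `C → F_Φ` alone, `κ` injective and `Φ'` non-dilating on `C`. [cite: MochizukiFrdI2008, Thm. 4.2 p.77] -/
theorem thm42Setting_ofFunctor_compMap (hst : (ofFunctor Φ F).IsOfStandardType)
    (hiso : (ofFunctor Φ F).IsOfIsotropicType) (hng : ¬ (ofFunctor Φ F).IsOfGroupLikeType)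
    (he : (ofFunctor Φ' (F ⋙ ElemFrobenioid.map κ)).IsNonDilatingOn) :
    Thm42Setting (ofFunctor Φ F) (ofFunctor Φ' (F ⋙ ElemFrobenioid.map κ)) where
  standard := ⟨hst, ofFunctor_compMap_isOfStandardType F κ hκ hst he⟩
  isotropic := ⟨hiso, ofFunctor_compMap_isOfIsotropicType F κ hκ hiso⟩
  notGroupLike := ⟨hng, ofFunctor_compMap_not_isOfGroupLikeType F κ hκ hng⟩

end CompMap

/-- Over a base category all of whose endomorphisms are identities, every divisor monoid is non-dilating
(Def. 1.1 (ii): the induced endomorphisms of `Φ(X)` are identities). [cite: MochizukiFrdI2008, Def. 1.1 (ii) p.19] -/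
theorem isNonDilatingOn_of_end_eq_id {C : Type u} [Category.{v} C] {D : Type u'} [Category.{v'} D]
    (S : PreFrobenioidData.{w} C D) (hD : ∀ (X : D) (f : X ⟶ X), f = 𝟙 X) : S.IsNonDilatingOn := by
  refine ⟨fun X f _ a => ?_⟩
  obtain ⟨a, rfl⟩ := Associates.mk_surjective a
  rw [associatesMap_mk, hD X f, S.pull_id]

end PreFrobenioidData

/-! ### Primes of `ℤ_{≥0}` and of `ℤ_{≥0} × ℤ_{≥0}` -/

namespace DegreeModel

open PreFrobenioidData

/-- Divisibility in `(ℕ, +)` written multiplicatively is `≤`. [cite: MochizukiFrdI2008, §0 p.12] -/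
theorem dvd_iff_le_N (a b : N) : a ∣ b ↔ a.toAdd ≤ b.toAdd := by
  constructor
  · rintro ⟨c, rfl⟩
    rw [toAdd_mul]
    exact Nat.le_add_right _ _
  · intro h
    obtain ⟨c, hc⟩ := Nat.exists_eq_add_of_le h
    exact ⟨Multiplicative.ofAdd c, Multiplicative.toAdd.injective (by rw [toAdd_mul, toAdd_ofAdd]; exact hc)⟩

/-- In `ℤ_{≥0}` every element is `≼` every non-zero element. [cite: MochizukiFrdI2008, §0 p.12] -/
theorem precsim_N (a : N) {b : N} (hb : b ≠ 1) : Precsim a b := by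
  refine ⟨a.toAdd + 1, Nat.succ_pos _, (dvd_iff_le_N _ _).mpr ?_⟩
  have hb' : b.toAdd ≠ 0 := fun h => hb (Multiplicative.toAdd.injective h)
  rw [toAdd_pow, smul_eq_mul]
  calc a.toAdd ≤ a.toAdd + 1 := Nat.le_succ _
    _ = (a.toAdd + 1) * 1 := (mul_one _).symm
    _ ≤ (a.toAdd + 1) * b.toAdd := Nat.mul_le_mul_left _ (Nat.one_le_iff_ne_zero.mpr hb')

/-- Every non-zero element of `ℤ_{≥0}` is primary. [cite: MochizukiFrdI2008, §0 p.12] -/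
theorem isPrimary_N {a : N} (ha : a ≠ 1) : IsPrimary a :=
  ⟨ha, fun _ hb _ => precsim_N a hb⟩

/-- Multiplication by `k + 2` is cancellable on `ℤ_{≥0}` (stated through `toAdd`). [folklore] -/
private theorem sq_injective_N {a b : N} {k : ℕ} (h : (k + 1 + 1) * Multiplicative.toAdd a = (k + 1 + 1) * Multiplicative.toAdd b) :
    a = b :=
  Multiplicative.toAdd.injective (Nat.eq_of_mul_eq_mul_left (Nat.succ_pos _) h)

/-- `ℤ_{≥0}` has exactly one prime: `Prime(ℤ_{≥0})` is a subsingleton. [cite: MochizukiFrdI2008, §0 p.12] -/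
theorem subsingleton_primes_N : Subsingleton (Primes N) := by
  refine ⟨fun p q => ?_⟩
  induction p using Quotient.inductionOn with | h a => ?_
  induction q using Quotient.inductionOn with | h b => ?_
  exact Quotient.sound (precsim_N (a : N) b.2.1)

/-- Divisibility in `ℤ_{≥0} × ℤ_{≥0}` is componentwise. [folklore] -/
private theorem prod_dvd_iff {a b : N × N} : a ∣ b ↔ a.1 ∣ b.1 ∧ a.2 ∣ b.2 := by
  constructor
  · rintro ⟨c, rfl⟩
    exact ⟨⟨c.1, rfl⟩, ⟨c.2, rfl⟩⟩
  · rintro ⟨⟨c₁, h₁⟩, ⟨c₂, h₂⟩⟩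
    exact ⟨(c₁, c₂), Prod.ext h₁ h₂⟩

/-- In `ℤ_{≥0}`, `a ∣ 0` forces `a = 0`. [folklore] -/
private theorem eq_one_of_dvd_one_N {a : N} (h : a ∣ 1) : a = 1 := by
  rw [dvd_iff_le_N, toAdd_one, Nat.le_zero] at h
  exact Multiplicative.toAdd.injective h

/-- `(1, 0) ∈ ℤ_{≥0} × ℤ_{≥0}` is primary. [cite: MochizukiFrdI2008, §0 p.12] -/
theorem isPrimary_inl : IsPrimary ((Multiplicative.ofAdd 1, 1) : N × N) := by
  refine ⟨fun h => Nat.one_ne_zero (congrArg (fun x : N × N => x.1.toAdd) h), fun b hb ⟨n, hn, hdvd⟩ => ?_⟩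
  rw [Prod.pow_mk, one_pow, prod_dvd_iff] at hdvd
  have hb2 : b.2 = 1 := eq_one_of_dvd_one_N hdvd.2
  have hb1 : b.1 ≠ 1 := fun h => hb (Prod.ext h hb2)
  refine ⟨1, Nat.one_pos, ?_⟩
  rw [pow_one, prod_dvd_iff, hb2]
  exact ⟨(dvd_iff_le_N _ _).mpr (Nat.one_le_iff_ne_zero.mpr fun h => hb1 (Multiplicative.toAdd.injective h)),
    dvd_rfl⟩

/-- `(0, 1) ∈ ℤ_{≥0} × ℤ_{≥0}` is primary. [cite: MochizukiFrdI2008, §0 p.12] -/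
theorem isPrimary_inr : IsPrimary ((1, Multiplicative.ofAdd 1) : N × N) := by
  refine ⟨fun h => Nat.one_ne_zero (congrArg (fun x : N × N => x.2.toAdd) h), fun b hb ⟨n, hn, hdvd⟩ => ?_⟩
  rw [Prod.pow_mk, one_pow, prod_dvd_iff] at hdvd
  have hb1 : b.1 = 1 := eq_one_of_dvd_one_N hdvd.1
  have hb2 : b.2 ≠ 1 := fun h => hb (Prod.ext hb1 h)
  refine ⟨1, Nat.one_pos, ?_⟩
  rw [pow_one, prod_dvd_iff, hb1]
  exact ⟨dvd_rfl,
    (dvd_iff_le_N _ _).mpr (Nat.one_le_iff_ne_zero.mpr fun h => hb2 (Multiplicative.toAdd.injective h))⟩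

/-- `ℤ_{≥0} × ℤ_{≥0}` has (at least) two primes: the classes of `(1, 0)` and `(0, 1)` differ.
[cite: MochizukiFrdI2008, §0 p.12] -/
theorem exists_ne_primes_prod : ∃ p q : Primes (N × N), p ≠ q := by
  refine ⟨Quotient.mk _ ⟨_, isPrimary_inl⟩, Quotient.mk _ ⟨_, isPrimary_inr⟩, fun h => ?_⟩
  obtain ⟨n, -, hdvd⟩ : Precsim ((Multiplicative.ofAdd 1, 1) : N × N) (1, Multiplicative.ofAdd 1) :=
    Quotient.exact h
  rw [Prod.pow_mk, one_pow, prod_dvd_iff] at hdvd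
  have := eq_one_of_dvd_one_N hdvd.1
  exact Nat.one_ne_zero (congrArg Multiplicative.toAdd this)

/-! ### The degree model: the setting of Thm. 4.2 for the pair (`C → F_Φ`, `C → F_Φ → F_{Φ'}`) -/

/-- The degree model is of isotropic type (Thm. 5.2 (ii)). [cite: MochizukiFrdI2008, Thm. 5.2 (ii) p.101] -/
theorem isOfIsotropicType_data : (ModelFrobenioid.data natΦ B DivB).IsOfIsotropicType :=
  ModelFrobenioid.data_isOfIsotropicType objectwise_isGroupLike_B

/-- The degree model is not of group-like type (`Φ(pt) = ℤ_{≥0} ≠ 0`). [cite: MochizukiFrdI2008, Def. 1.2 (v) p.23] -/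
theorem not_isOfGroupLikeType_data : ¬ (ModelFrobenioid.data natΦ B DivB).IsOfGroupLikeType := fun h =>
  Nat.one_ne_zero (congrArg Multiplicative.toAdd (h.obj (ι 0) (Multiplicative.ofAdd 1 : N)))

/-- **The hypotheses of Thm. 4.2 hold for the pair** (degree model `C → F_Φ`, its composite `C → F_Φ → F_{Φ'}` with
an injective change of divisor monoid `κ : Φ → Φ'`): both of standard and isotropic type, neither group-like
(every divisor monoid on the one-morphism base is non-dilating). [cite: MochizukiFrdI2008, Thm. 4.2 p.77] -/
theorem thm42Setting_compMap {Φ' : Dᵒᵖ ⥤ CommMonCat.{0}} (κ : natΦ ⟶ Φ')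
    (hκ : ∀ A : Dᵒᵖ, Function.Injective (κ.app A).hom) :
    Thm42Setting (ModelFrobenioid.data natΦ B DivB) (ofFunctor Φ' (F ⋙ ElemFrobenioid.map κ)) :=
  thm42Setting_ofFunctor_compMap F κ hκ isOfStandardType isOfIsotropicType_data not_isOfGroupLikeType_data
    (isNonDilatingOn_of_end_eq_id _ fun _ _ => Subsingleton.elim _ _)

/-! ### Thm. 4.2 (ii) AS TYPED fails for (`C → F_Φ`, `C → F_Φ → F_{Φ × Φ}`, `Ψ = 𝟭`): no prime bijection -/

/-- **Counter-model to the universal closure of `Thm42ii`.** For the degree model `C → F_Φ` (`Φ ≡ ℤ_{≥0}` on the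
one-morphism base; a Frobenioid of standard and isotropic, non-group-like type — Thm. 5.2) and the pre-Frobenioid
`C → F_Φ → F_{Φ'}` obtained from it by the DIAGONAL change of divisor monoid `Φ → Φ' := Φ × Φ` (Def. 1.1 (iii);
injective, so the typed hypotheses `Thm42Setting` transport), with `Ψ = 𝟭_C`, the typed conclusion of Thm. 4.2 (ii)
fails: `Prime(Φ(pt))` has one element and `Prime(Φ'(pt))` has two, so no family `Ψ^Prime` of bijections exists.
(The second structure is a pre-Frobenioid but not a Frobenioid — `(1, 0)` is no zero divisor of an arrow —, which
is exactly why `IsFrobenioid` is the faithful hypothesis of the landed instance forms.)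
[cite: MochizukiFrdI2008, Thm. 4.2 (ii) p.77] -/
theorem not_thm42ii_diag :
    ¬ (ModelFrobenioid.data natΦ B DivB).Thm42ii
        (ofFunctor ((Functor.const Dᵒᵖ).obj (CommMonCat.of (N × N)))
          (F ⋙ ElemFrobenioid.map
            ((Functor.const Dᵒᵖ).map (CommMonCat.ofHom ((MonoidHom.id N).prod (MonoidHom.id N))))))
        CategoryTheory.Equivalence.refl := by
  intro h
  obtain ⟨e, -, -⟩ := h (thm42Setting_compMap _ fun A x y hxy => (Prod.ext_iff.mp hxy).1)
  obtain ⟨p, q, hpq⟩ := exists_ne_primes_prod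
  have e₀ : Primes N ≃ Primes (N × N) := e (ι 0)
  haveI := subsingleton_primes_N
  exact hpq (e₀.symm.injective (Subsingleton.elim _ _))

/-! ### Thm. 4.2 (iii) AS TYPED fails for (`C → F_Φ`, `C → F_Φ →[2] F_Φ`, `Ψ = 𝟭`, `Ψ^Prime = id`) -/

/-- The zero divisor of an arrow of the degree model, from the degree law. [cite: MochizukiFrdI2008, Thm. 5.2 (i) p.100] -/
theorem toAdd_dv_eq {X Y : C} (φ : X ⟶ Y) :
    ((dv φ).toAdd : ℤ) = dg Y - (ModelFrobenioid.degFr φ : ℕ) * dg X := by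
  rw [dg_eq φ]; ring

/-- **The object of degree `0` of the degree model is Div-Frobenius-trivial**: `n ↦` (the unique endomorphism of
Frobenius degree `n`) is a homomorphism `ℕ_{≥1} → End(ι 0)` whose values are Div-identity (all pull-backs of `Φ`
are identities) base-identity isometries, hence of Frobenius type (every arrow of a model Frobenioid is co-angular).
[cite: MochizukiFrdI2008, Def. 1.2 (iv) p.22] -/
theorem isDivFrobeniusTrivial_ι_zero : (ModelFrobenioid.data natΦ B DivB).IsDivFrobeniusTrivial (ι 0) := by
  have h0 : ∀ n : ℕ+, ((n : ℕ) : ℤ) * dg (ι 0) ≤ dg (ι 0) := fun n => by rw [dg_ι, mul_zero]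
  refine ⟨{ toFun := fun n => homOf (ι 0) (ι 0) n (h0 n), map_one' := ?_, map_mul' := ?_ },
    fun n => ⟨rfl, fun _ => rfl, ?_⟩⟩
  · exact hom_eq_of_degFr_eq _ _ ((ModelFrobenioid.data natΦ B DivB).degFr_id (ι 0)).symm
  · intro m n
    exact hom_eq_of_degFr_eq _ _
      (((ModelFrobenioid.data natΦ B DivB).degFr_comp (homOf (ι 0) (ι 0) n (h0 n))
        (homOf (ι 0) (ι 0) m (h0 m))).trans (mul_comm _ _)).symm
  · refine ⟨⟨(ofFunctor_isCoAngular F _).mpr (ModelFrobenioid.isCoAngular objectwise_isGroupLike_B _), ?_⟩,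
      isIso_D _⟩
    -- isometric: `Div = deg(ι 0) - n · deg(ι 0) = 0`
    have h := toAdd_dv_eq (homOf (ι 0) (ι 0) n (h0 n))
    rw [dg_ι, mul_zero, sub_zero, Nat.cast_eq_zero] at h
    exact Multiplicative.toAdd.injective h

/-- Out of the object of degree `0` there is a co-angular pre-step (a linear arrow) with any prescribed zero divisor
`x ∈ ℤ_{≥0}` — namely to the object of degree `x`. [cite: MochizukiFrdI2008, Thm. 5.2 (i) p.100] -/
theorem exists_coAngularPreStep_div_eq (x : N) :
    ∃ (Y : C) (φ : ι 0 ⟶ Y), (ModelFrobenioid.data natΦ B DivB).IsCoAngularPreStep φ ∧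
      (ModelFrobenioid.data natΦ B DivB).div φ = x := by
  have hle : ((1 : ℕ+) : ℕ) * dg (ι 0) ≤ dg (ι (x.toAdd : ℤ)) := by
    rw [dg_ι, dg_ι, mul_zero]; exact Int.natCast_nonneg _
  refine ⟨ι (x.toAdd : ℤ), homOf _ _ 1 hle,
    ⟨(ofFunctor_isCoAngular F _).mpr (ModelFrobenioid.isCoAngular objectwise_isGroupLike_B _), rfl, isIso_D _⟩, ?_⟩
  have h := toAdd_dv_eq (homOf _ _ 1 hle)
  rw [dg_ι, dg_ι, mul_zero, sub_zero, Nat.cast_inj] at h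
  exact Multiplicative.toAdd.injective h

/-- **Counter-model to the universal closure of `Thm42iii`.** For the degree model `C → F_Φ` (Thm. 5.2; standard,
isotropic, not group-like) and the pre-Frobenioid `C → F_Φ → F_Φ` obtained by composing with the Frobenius functor
"multiplication by `2` on `Φ`" (Prop. 2.1 (ii) / Def. 2.4 (iii); an injective change of divisor monoid, so
`Thm42Setting` transports), with `Ψ = 𝟭_C` and the identity family of prime bijections (`Prime(ℤ_{≥0})` is a
point), the typed conclusion of Thm. 4.2 (iii) fails at the Div-Frobenius-trivial object `ι 0` of degree `0`: a
right-hand isomorphism of monoids `r : Φ(pt)_𝔭 ⥲ Φ(pt)_𝔭` computing the divisors of the images of the co-angular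
pre-steps `ι 0 → ι x` would satisfy `r(x) = 2x` for every `x ∈ ℤ_{≥0}`, and `1 ∉ 2ℤ_{≥0}`. (Again the second
structure is no Frobenioid; for Frobenioids Thm. 4.2 (iii) as typed is the tree's
`FrdI.T42.thm42iii_ofFunctor_of_isOfFSMFFType2024` / `…_of_preservesPreSteps`.) [cite: MochizukiFrdI2008, Thm. 4.2 (iii) p.78] -/
theorem not_thm42iii_powEnd :
    ¬ (ModelFrobenioid.data natΦ B DivB).Thm42iii (ofFunctor natΦ (F ⋙ ElemFrobenioid.map (powEnd natΦ 2)))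
        CategoryTheory.Equivalence.refl (fun _ => Equiv.refl _) := by
  intro h
  have h2 : ∀ c : N, Multiplicative.toAdd (c ^ ((2 : ℕ+) : ℕ)) = 2 * Multiplicative.toAdd c := fun c => by
    rw [toAdd_pow, smul_eq_mul]; rfl
  have hκ : ∀ A : Dᵒᵖ, Function.Injective ((powEnd natΦ 2).app A).hom := fun A a b hab =>
    sq_injective_N (((h2 _).symm.trans (congrArg (Multiplicative.toAdd : N → ℕ) hab)).trans (h2 _))
  have h1 : (Multiplicative.ofAdd (1 : ℕ) : N) ≠ 1 := fun h => Nat.one_ne_zero (congrArg Multiplicative.toAdd h)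
  let 𝔭 : Primes N := Quotient.mk _ ⟨Multiplicative.ofAdd (1 : ℕ), isPrimary_N h1⟩
  have hmem : (Multiplicative.ofAdd (1 : ℕ) : N) ∈ 𝔭.submonoid := Submonoid.subset_closure ⟨isPrimary_N h1, rfl⟩
  obtain ⟨⟨r, hr⟩, -⟩ := h (thm42Setting_compMap _ hκ) (ι 0) isDivFrobeniusTrivial_ι_zero 𝔭
  -- the element `1 ∈ Φ(pt)_𝔭` is a value of `r`, say of `x`; `x` is the zero divisor of a co-angular pre-step `φ`
  obtain ⟨⟨x, hx⟩, hy⟩ := r.surjective ⟨(Multiplicative.ofAdd (1 : ℕ) : N), hmem⟩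
  obtain ⟨Y, φ, hφ, hdiv⟩ := exists_coAngularPreStep_div_eq x
  subst hdiv
  -- clause (iii), right-hand isomorphism, at `φ`: `r(Div φ) = Div'(Ψ φ) = 2 · Div(φ)`, i.e. `1 = 2 · Div(φ)`
  have key := hr φ hφ hx
  rw [hy] at key
  have key' : (1 : ℕ) = 2 * (Multiplicative.toAdd : N → ℕ) ((ModelFrobenioid.data natΦ B DivB).div φ) :=
    (congrArg (Multiplicative.toAdd : N → ℕ) key).trans (h2 _)
  omega

end DegreeModel

/-! ### FACT-LIST rows F-1054 / F-1055: the universal closures are refuted -/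

/-- **FACT-LIST F-1054 (`PreFrobenioidData.Thm42ii`), universal closure REFUTED** (witness: `DegreeModel.not_thm42ii_diag`
— the degree model and its diagonal change of divisor monoid, `Ψ = 𝟭`). Thm. 4.2 (ii) is typed as a conclusion
predicate over the bare operations interface `PreFrobenioidData` (Def. 1.1 (iv) + Rem. 1.1.1), which admits
pre-Frobenioids that are not Frobenioids; print asserts it for FROBENIOIDS (with `Φ_i` perf-factorial), and in that
instance form the tree proves it: `FrdI.T42.thm42ii_ofFunctor_of_isOfFSMFFType2024`,
`FrdI.T42.thm42ii_ofFunctor_of_preservesPreSteps`, `PreFrobenioidData.thm42ii_of_perfectType_asPrinted`. Refuted at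
universe `0`; a refuted closure is never a fact, no statement of the paper is asserted false (R5: NAMED instances
only). [cite: MochizukiFrdI2008, Thm. 4.2 (ii) p.77] -/
theorem not_forall_thm42ii :
    ¬ ∀ (C₁ : Type) [SmallCategory C₁] (D₁ : Type) [SmallCategory D₁] (C₂ : Type) [SmallCategory C₂]
        (D₂ : Type) [SmallCategory D₂] (S₁ : PreFrobenioidData.{0} C₁ D₁) (S₂ : PreFrobenioidData.{0} C₂ D₂)
        (Ψ : C₁ ≌ C₂), S₁.Thm42ii S₂ Ψ :=
  fun h => DegreeModel.not_thm42ii_diag (h _ _ _ _ _ _ _)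

/-- **FACT-LIST F-1055 (`PreFrobenioidData.Thm42iii`), universal closure REFUTED** (witness:
`DegreeModel.not_thm42iii_powEnd` — the degree model and its Frobenius functor `[2]`, `Ψ = 𝟭`, `Ψ^Prime = id`).
Thm. 4.2 (iii) is typed over the bare interface `PreFrobenioidData` and over an ARBITRARY family `e` of prime
bijections; print asserts it for Frobenioids and THE family of (ii), and in that instance form the tree proves it:
`FrdI.T42.thm42iii_ofFunctor_of_isOfFSMFFType2024`, `FrdI.T42.thm42iii_ofFunctor_of_preservesPreSteps`,
`FrdI.T42.thm42ii_iii_ofFunctor_of_isOfFSMFFType2024`, `PreFrobenioidData.thm42iii_of`. Refuted at universe `0`;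
R5: NAMED instances only. [cite: MochizukiFrdI2008, Thm. 4.2 (iii) p.78] -/
theorem not_forall_thm42iii :
    ¬ ∀ (C₁ : Type) [SmallCategory C₁] (D₁ : Type) [SmallCategory D₁] (C₂ : Type) [SmallCategory C₂]
        (D₂ : Type) [SmallCategory D₂] (S₁ : PreFrobenioidData.{0} C₁ D₁) (S₂ : PreFrobenioidData.{0} C₂ D₂)
        (Ψ : C₁ ≌ C₂)
        (e : ∀ A : C₁, Primes (S₁.Mon (S₁.base.obj A)) ≃ Primes (S₂.Mon (S₂.base.obj (Ψ.functor.obj A)))),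
        S₁.Thm42iii S₂ Ψ e :=
  fun h => DegreeModel.not_thm42iii_powEnd (h _ _ _ _ _ _ _ _)

end Literature.AlgebraicGeometry.Frobenioids
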